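/-
Copyright (c) 2026 the pub-hodgecm-mathlib formalisation cell (harness21).  Prover seat hodgecm-mathlib-K2Liu-p07 (g3), Track B «K2-LIT»,
#184♮ = hLiu418 = `stmt-HodgeConjecture-24832`; #42S payer road, organ S1 (local Siegel–Weil spanning), ROAD W row (R-g) (DESIGN-F7r-Assembly §4: the
group-level Levi–unipotent split of `P_Δ` elements, used by the dilation invariance (d) of ★ F7r-4∕F7r-5).
-/
import Literature.NumberTheory.GelbartRogawski1991.LocalDoubledUnitaryKudlaSplitting     -- ★ GR: `isUnit_det_blkA_of_blkC_eq_zero`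
import Literature.NumberTheory.GelbartRogawski1991.LocalDoubledUnitaryUnramifiedCell    -- ★ GR: `nElem`, `nElem_inv`, `adapt_matA_nElem`, `isSiegelDelta_nElem` (+ Iwahori: `IsSiegelDelta`, `isSiegelDelta_iff_blkC_eq_zero`)
import Literature.NumberTheory.GelbartRogawski1991.LocalDoubledUnitaryBigCellValue        -- ★ GR: `gramS_transpose`, `gramS_map_conj`, `conjLocal_conjLocal'`
import HarnessLib

/-!
# Crux `HLiu418`, #42S organ S1, ROAD W, row (R-g): EVERY `p ∈ P_Δ` IS `m · n(t)` WITH `m` OF LEVI TYPE AND `t = A⁻¹B`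

Cell `hodgecm-mathlib`, crux item hLiu418 = `stmt-HodgeConjecture-24832`; squad K2 ∕ K2Liu; LEAD F0P6-plan (g14), organ lead K2Liu-p06 (g4);
prover K2Liu-p07 (g3).  THEOREMS ONLY (no `def`, no instance, no notation, no named-fact hypothesis, no `sorry`); lane
`--supports stmt-HodgeConjecture-24832 --as helper`.

WHY.  The dilation invariance (d) of the ramified witness (★ F7r-4 `middleCell_comp_eq`, ★ F7r-5) compares `F(w₁ · Ad_{d_a} x)` and `F(w₁ · x)` for `x ∈ P_Δ`;
`Ad_{d_a}` fixes Levi-type elements (★ F7r-4 `localCongr_dA_eq_self_of_blkB_blkC`) and rescales unipotent ones (★ C1 `localCongr_dA_nElem`), so one needs the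
GROUP-LEVEL split `x = m · n(t)`, `m` of Levi type (`B = C = 0`), `n(t) = nElem t` — this file.  For `p ∈ P_Δ` with adapted blocks `[[A, B], [0, D]]`: `A` is
invertible (★ `isUnit_det_blkA_of_blkC_eq_zero`), `t := A⁻¹B` is `𝕊`-skew by the unitarity relations `AᴴSD = S`, `DᴴSA = S`, `DᴴSB + BᴴSD = 0` (★ `rel₁₂`, `rel₂₁`,
`rel₂₂`), and `m := p · n(t)⁻¹ = p · n(−t)` has adapted blocks `[[A, 0], [0, D]]`.
* `skew_inv_blkA_mul_blkB` — `t = A⁻¹B` is skew: `tᴴ S + S t = 0`;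
* **`exists_levi_mul_nElem`** — `p = m · nElem (A⁻¹B)` with `m ∈ P_Δ`, `blkB (matA m) = 0`, `blkA (matA m) = A`, `blkD (matA m) = D`.
References: [Kudla1994] §3; [Weil1964] n° 32; [MoeglinVignerasWaldspurger1987] Chap. 2 II.6.
HONEST LABEL.  Count-neutral helper: `HC_CM` is proved only modulo the 7 printed citations (2 remaining named inputs: hLiu418 = `stmt-HodgeConjecture-24832`,
h413 = `stmt-HodgeConjecture-24833`) until rung 0 closes.
-/

set_option autoImplicit false
set_option linter.dupNamespace false -- the mandated namespace repeats `HodgeConjecture.HodgeConjecture`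

noncomputable section

open scoped Matrix
open NumberField IsDedekindDomain Matrix
open Literature.NumberTheory.Automorphic Literature.NumberTheory.Automorphic.UnitaryGroup
open Literature.NumberTheory.GelbartRogawski1991 Literature.NumberTheory.GelbartRogawski1991.AdaptedBlocks
open Literature.NumberTheory.GelbartRogawski1991.UnitaryDualPair.LocalSplitting

namespace Summit.HodgeConjecture.HodgeConjecture.Cruxes.HLiu418.K2LiuSiegelDeltaLeviUnipotent

variable (F : Type) [Field F] [NumberField F] (E : Type) [Field E] [NumberField E] [Algebra F E] [Algebra.IsQuadraticExtension F E]
  (c : E ≃ₐ[F] E) {δ : E} (hcδ : c δ = -δ) (hδ : δ ≠ 0) {d : F} (hd : δ * δ = algebraMap F E d)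
  (v : HeightOneSpectrum (𝓞 F)) (n : ℕ) {T₀ : Matrix (Fin n) (Fin n) F} (hT₀ : T₀.IsSymm)
  {JD : Matrix (Fin (n + n)) (Fin (n + n)) E} (hJD : JD = (gramD F n T₀).map (algebraMap F E))

include hcδ hδ hd hT₀ hJD in
/-- **`t = A⁻¹B` is `𝕊`-skew** for `p ∈ P_Δ` with adapted blocks `[[A, B], [0, D]]`: `tᴴ 𝕊 + 𝕊 t = Bᴴ𝕊D + Dᴴ𝕊B = 0`, by the unitarity relations `Aᴴ𝕊D = 𝕊` (★ `rel₁₂`),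
`Dᴴ𝕊A = 𝕊` (★ `rel₂₁`) and `Dᴴ𝕊B + Bᴴ𝕊D = 0` (★ `rel₂₂`) at `C = 0`. [cite: Kudla1994, §3] [cite: Weil1964, n° 32] -/
theorem skew_inv_blkA_mul_blkB (p : UnitaryGroup.localPi E c (n + n) JD v) (hp : IsSiegelDelta F E c hcδ hδ hd v n hT₀ hJD p) :
    (((blkA (matA F E c v n p))⁻¹ * blkB (matA F E c v n p)).map (conjLocal E c v))ᵀ * gramS F E v n T₀ +
        gramS F E v n T₀ * ((blkA (matA F E c v n p))⁻¹ * blkB (matA F E c v n p)) = 0 := by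
  have hC : blkC (matA F E c v n p) = 0 := (isSiegelDelta_iff_blkC_eq_zero F E c hcδ hδ hd v n hT₀ hJD p).1 hp
  have hA : IsUnit (blkA (matA F E c v n p)).det := isUnit_det_blkA_of_blkC_eq_zero F E c v n hC
  have hrel := cstar_matA F E c v n hJD p
  have h12 := rel₁₂ hrel
  have h21 := rel₂₁ hrel
  have h22 := rel₂₂ hrel
  rw [hC] at h12 h21
  rw [Matrix.map_zero _ (map_zero _), Matrix.transpose_zero, Matrix.zero_mul, Matrix.zero_mul, zero_add] at h12
  rw [Matrix.mul_zero, add_zero] at h21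
  set A := blkA (matA F E c v n p)
  set B := blkB (matA F E c v n p)
  set D := blkD (matA F E c v n p)
  set S := gramS F E v n T₀
  -- `(A⁻¹)ᴴ Aᴴ = 1`
  have hinv : ((A⁻¹).map (conjLocal E c v))ᵀ * (A.map (conjLocal E c v))ᵀ = 1 := by
    rw [← Matrix.transpose_mul, ← Matrix.map_mul, Matrix.mul_nonsing_inv _ hA, Matrix.map_one _ (map_zero _) (map_one _),
      Matrix.transpose_one]
  -- `tᴴ S = Bᴴ S D`
  have h1 : ((A⁻¹ * B).map (conjLocal E c v))ᵀ * S = (B.map (conjLocal E c v))ᵀ * S * D := by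
    calc ((A⁻¹ * B).map (conjLocal E c v))ᵀ * S
        = (B.map (conjLocal E c v))ᵀ * ((A⁻¹).map (conjLocal E c v))ᵀ * ((A.map (conjLocal E c v))ᵀ * S * D) := by
          rw [h12, Matrix.map_mul, Matrix.transpose_mul]
      _ = (B.map (conjLocal E c v))ᵀ * (((A⁻¹).map (conjLocal E c v))ᵀ * (A.map (conjLocal E c v))ᵀ) * S * D := by
          simp only [Matrix.mul_assoc]
      _ = (B.map (conjLocal E c v))ᵀ * S * D := by rw [hinv, Matrix.mul_one]
  -- `S t = Dᴴ S B`
  have h2 : S * (A⁻¹ * B) = (D.map (conjLocal E c v))ᵀ * S * B := by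
    calc S * (A⁻¹ * B) = (D.map (conjLocal E c v))ᵀ * S * A * (A⁻¹ * B) := by rw [h21]
      _ = (D.map (conjLocal E c v))ᵀ * S * (A * A⁻¹) * B := by simp only [Matrix.mul_assoc]
      _ = (D.map (conjLocal E c v))ᵀ * S * B := by rw [Matrix.mul_nonsing_inv _ hA, Matrix.mul_one]
  rw [h1, h2, add_comm, h22]

include hcδ hδ hd hT₀ hJD in
/-- **EVERY `p ∈ P_Δ` IS `m · n(t)`** with `m ∈ P_Δ` of LEVI TYPE (`blkB (matA m) = 0`, same `A`- and `D`-blocks as `p`) and `t = A⁻¹B` (`n(t) = nElem t`, skew by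
`skew_inv_blkA_mul_blkB`): `P_Δ = M_Δ ⋉ N_Δ` at the level of elements. [cite: Kudla1994, §3] [cite: Weil1964, n° 32] [cite: MoeglinVignerasWaldspurger1987, Chap. 2 II.6] -/
theorem exists_levi_mul_nElem (p : UnitaryGroup.localPi E c (n + n) JD v) (hp : IsSiegelDelta F E c hcδ hδ hd v n hT₀ hJD p) :
    ∃ m : UnitaryGroup.localPi E c (n + n) JD v,
      IsSiegelDelta F E c hcδ hδ hd v n hT₀ hJD m ∧ blkB (matA F E c v n m) = 0 ∧
        blkA (matA F E c v n m) = blkA (matA F E c v n p) ∧ blkD (matA F E c v n m) = blkD (matA F E c v n p) ∧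
          p = m * nElem F E c v n hJD ((blkA (matA F E c v n p))⁻¹ * blkB (matA F E c v n p))
            (skew_inv_blkA_mul_blkB F E c hcδ hδ hd v n hT₀ hJD p hp) := by
  have hC : blkC (matA F E c v n p) = 0 := (isSiegelDelta_iff_blkC_eq_zero F E c hcδ hδ hd v n hT₀ hJD p).1 hp
  have hA : IsUnit (blkA (matA F E c v n p)).det := isUnit_det_blkA_of_blkC_eq_zero F E c v n hC
  have ht := skew_inv_blkA_mul_blkB F E c hcδ hδ hd v n hT₀ hJD p hp
  refine ⟨p * (nElem F E c v n hJD _ ht)⁻¹, ?_, ?_, ?_, ?_, (inv_mul_cancel_right p _).symm⟩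
  all_goals rw [nElem_inv F E c v n hJD _ ht]
  · exact hp.mul (isSiegelDelta_nElem F E c hcδ hδ hd v n hT₀ hJD _ _)
  · have hn := adapt_matA_nElem F E c v n hJD (-((blkA (matA F E c v n p))⁻¹ * blkB (matA F E c v n p))) (skew_neg F E c v n ht)
    rw [adapt_eq] at hn
    obtain ⟨hnA, hnB, -, hnD⟩ := Matrix.fromBlocks_inj.1 hn
    rw [← matA_mul, blkB_mul, hnB, hnD, Matrix.mul_one, Matrix.mul_neg, ← Matrix.mul_assoc, Matrix.mul_nonsing_inv _ hA, Matrix.one_mul,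
      neg_add_cancel]
  · have hn := adapt_matA_nElem F E c v n hJD (-((blkA (matA F E c v n p))⁻¹ * blkB (matA F E c v n p))) (skew_neg F E c v n ht)
    rw [adapt_eq] at hn
    obtain ⟨hnA, -, hnC, -⟩ := Matrix.fromBlocks_inj.1 hn
    rw [← matA_mul, blkA_mul, hnA, hnC, Matrix.mul_one, Matrix.mul_zero, add_zero]
  · have hn := adapt_matA_nElem F E c v n hJD (-((blkA (matA F E c v n p))⁻¹ * blkB (matA F E c v n p))) (skew_neg F E c v n ht)
    rw [adapt_eq] at hn
    obtain ⟨-, hnB, -, hnD⟩ := Matrix.fromBlocks_inj.1 hn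
    rw [← matA_mul, blkD_mul, hC, hnD, Matrix.zero_mul, zero_add, Matrix.mul_one]

end Summit.HodgeConjecture.HodgeConjecture.Cruxes.HLiu418.K2LiuSiegelDeltaLeviUnipotent
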